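import Mathlib
import HarnessLib
import Summits.NavierStokesRegularity.NavierStokesRegularity.Theorems.IsobarTomographyBlobRiccatiClosureStubUniformDecay
import Summits.NavierStokesRegularity.NavierStokesRegularity.Theorems.IsobarTomographyBlobRiccatiClosureStubSupGronwall

/-!
# Crux `IsobarTomography.BlobRiccatiClosure` (stmt-NavierStokesRegularity-11740),
# line `type-i-apex-liouville`, stub B3 `stub_argmaxSlice` — the vorticity maximum of a slice is attained

Registered stub B3 of the extremal-apex skeleton: for a classical solution `(u, p)` of the unforced
Navier–Stokes system (viscosity `ν > 0`) on `ℝ³ × [0, T)` which is Leray–Hopf from its rapidly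
decaying datum, at every time `t ∈ [0, T)` at which the vorticity `ω(t, ·) = curl (u t)` does not
vanish identically, the function `y ↦ ‖curl (u t) y‖` attains its maximum on `ℝ³`.

Proof. By the landed slab decay `Sketch.stub_uniformDecay` (with `t₁ := t < T`), for every `ε > 0`
there is `R` with `‖curl (u s) x‖² ≤ ε` for `s ∈ [0, t]`, `‖x‖ ≥ R`; take `s = t` and
`ε := ‖curl (u t) x‖² / 2`, where `x` is the given point of non-zero vorticity. The slice
`φ = ‖curl (u t) ·‖²` is continuous (`u t` is smooth, `continuous_curl`), so the landed
`Sketch.supGronwall_sliceMax` (extreme value theorem on a closed ball) gives that `φ` is bounded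
above and, since `ε < φ x ≤ sup φ`, attains its supremum at some `x₀`; monotonicity of the square
root on nonnegative reals turns the argmax of `‖curl‖²` into an argmax of `‖curl‖`.

References: A. J. Majda, A. L. Bertozzi, *Vorticity and Incompressible Flow* (CUP 2002), §5.1
(the vorticity maximum as a blow-up diagnostic).
-/

-- the summit and its single sub-problem share the name (CONVENTIONS §1), as in every Theorems file
set_option linter.dupNamespace false

noncomputable section

namespace Summit.NavierStokesRegularity.NavierStokesRegularity.Theorems.BlobRiccatiClosure.TypeIApexLiouville

open Set Filter Topology Function MeasureTheory
open Literature.Analysis Literature.Analysis.FluidPDE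
open Summit.NavierStokesRegularity.NavierStokesRegularity.Theorems.BlobRiccatiClosure
open scoped ContDiff

/-- Euclidean `ℝ³`. -/
local notation "E³" => EuclideanSpace ℝ (Fin 3)

/-- **B3, THE VORTICITY MAXIMUM OF A SLICE IS ATTAINED.** For a classical solution on `[0, T)`,
Leray–Hopf from a rapidly decaying datum, at every time `t < T` at which the vorticity does not
vanish identically, `x ↦ ‖ω(t, x)‖` attains its maximum (uniform spatial decay of `‖ω‖²` on the
closed slab `[0, t]`, `Sketch.stub_uniformDecay`, + continuity and the extreme value theorem on a
closed ball, `Sketch.supGronwall_sliceMax`). The argmax lies in every non-empty superlevel set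
`{‖ω(t,·)‖ > Ω(t)}`, which is how the blob hypothesis is consumed at the zoom centres. -/
theorem stub_argmaxSlice :
    ∀ (ν T : ℝ) (u : ℝ → E³ → E³) (p : ℝ → E³ → ℝ), 0 < ν → 0 < T →
      IsClassicalNSSolutionOn (Ico 0 T) ν 0 u p → IsLerayHopfOn T ν 0 (u 0) u →
      HasRapidSpatialDecay (u 0) →
      ∀ t ∈ Ico 0 T, (∃ x : E³, 0 < ‖curl (u t) x‖) →
        ∃ x₀ : E³, ∀ y : E³, ‖curl (u t) y‖ ≤ ‖curl (u t) x₀‖ := by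
  intro ν T u p hν hT hcl hLH hdec t ht hx
  obtain ⟨x, hx⟩ := hx
  -- the slice `φ = ‖curl (u t) ·‖ ^ 2` is continuous
  set φ : E³ → ℝ := fun y => ‖curl (u t) y‖ ^ 2 with hφ_def
  have hsmooth : ContDiff ℝ ∞ (u t) := hcl.contDiff_velocity ht
  have hC1 : ContDiff ℝ 1 (u t) := hsmooth.of_le (by norm_cast)
  have hφc : Continuous φ := (continuous_curl hC1).norm.pow 2
  -- uniform decay on the slab `[0, t]`, used at the slice `s = t`
  have hε : 0 < ‖curl (u t) x‖ ^ 2 / 2 := by positivity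
  obtain ⟨R, hR⟩ :=
    (Sketch.stub_uniformDecay ν T u p hν hT hcl hLH hdec t ht.2).2 (‖curl (u t) x‖ ^ 2 / 2) hε
  have hdecay : ∀ y : E³, R ≤ ‖y‖ → φ y ≤ ‖curl (u t) x‖ ^ 2 / 2 := fun y hy =>
    hR t ⟨ht.1, le_rfl⟩ y hy
  -- boundedness and attainment of the supremum of `φ`
  obtain ⟨hbdd, hatt⟩ := Sketch.supGronwall_sliceMax hφc hdecay
  have hlt : ‖curl (u t) x‖ ^ 2 / 2 < ⨆ y, φ y := by
    have h1 : ‖curl (u t) x‖ ^ 2 / 2 < φ x := by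
      show ‖curl (u t) x‖ ^ 2 / 2 < ‖curl (u t) x‖ ^ 2
      linarith [pow_pos hx 2]
    exact h1.trans_le (le_ciSup hbdd x)
  obtain ⟨x₀, hx₀⟩ := hatt hlt
  exact ⟨x₀, fun y => (sq_le_sq₀ (norm_nonneg _) (norm_nonneg _)).1 (hx₀ y)⟩

end Summit.NavierStokesRegularity.NavierStokesRegularity.Theorems.BlobRiccatiClosure.TypeIApexLiouville

end
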